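/-
Copyright (c) 2026 the pub-hodgecm-mathlib formalisation cell (harness21).  Prover seat hodgecm-mathlib-K2Liu-p10 (g0), Track B «K2-LIT»,
#184♮ = hLiu418 = `stmt-HodgeConjecture-24832`; LEAD F0P6-plan (g12) DEAL 2026-09-04T06:17:21Z «WA», file WA-1 (road (R1) of the REPORT-FIRST
06:25Z): the rational points of the LIE ALGEBRA `𝔲(J) = {X | X^σᵀ J + J X = 0}` of a unitary group over a number field `E` are DENSE in the
archimedean Lie algebra `𝔲(J)(E ⊗_ℚ ℝ)` — via the retraction `Y ↦ Y − J⁻¹ Y^σᵀ J` and the density of `E` in `E ⊗ ℝ`.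
-/
import Literature.NumberTheory.Automorphic.ArchRegularOrbitClosed           -- ★ `conjMixed_conjMixed_of_apply_apply` (+ `conjMixed_mixedEmbedding`, `continuous_conjMixed`)
import Literature.NumberTheory.Automorphic.AdelicGLnGlue                     -- ★ `continuous_ringEquiv_mixedSpace`
import Mathlib.NumberTheory.NumberField.InfiniteAdeleRing
import Mathlib.Topology.Instances.Matrix
import HarnessLib

/-!
# Crux `HLiu418`, road `K2_Liu` (Road I v3, U2d «WA»), file WA-1: the rational unitary Lie algebra is dense in the archimedean one

Cell `hodgecm-mathlib`, crux item hLiu418 = `stmt-HodgeConjecture-24832`; squad K2, LEAD F0P6-plan (g12) (deal «WA» 2026-09-04T06:17:21Z), box K2E5-r01 (g6).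
THEOREMS ONLY (no `def`, no instance, no notation, no named-fact hypothesis, no `sorry`); lane `--supports stmt-HodgeConjecture-24832 --as helper`.

For a commutative ring `R` with an endomorphism `σ` and `J ∈ M_m(R)` write (spelled out, no definition) `X^† := (X.map σ)ᵀ` and
`𝔲(J)(R) := {X ∈ M_m(R) | X^† J + J X = 0}` — the Lie algebra of `U(σ, J)`.  [PlatonovRapinchuk1994, §7.1 (proof of Prop. 7.11: the Cayley
parametrisation of `U(J)` by `𝔲(J)`); §2.3.]
* §1 ring level: for `σ` an involution, `J^† = J` and a two-sided inverse `K` of `J`, the map `P_K(Y) := Y − K Y^† J` takes values in `𝔲(J)`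
  (`sub_mul_conjTranspose_mul_mem`), fixes `𝔲(J)` up to the factor `2` (`retraction_apply_of_mem`: `P_K(t Y) = Y` for `Y ∈ 𝔲(J)`, `σ t = t`, `t·2 = 1`),
  and commutes with ring homomorphisms intertwining the involutions (`map_retraction`);
* §2 number fields: `DenseRange (fun X : Matrix m m' E => X.map (mixedEmbedding E))` (Mathlib `InfiniteAdeleRing.denseRange_algebraMap` + ★
  `continuous_ringEquiv_mixedSpace`); `conjMixed` is an involution when `c` is (★ `conjMixed_conjMixed_of_apply_apply`);
* §3 **`unitaryLie_subset_closure_image`**: for `c` an involution of `E/F` and `J ∈ M_m(E)` hermitian (`(J.map c)ᵀ = J`) of unit determinant,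
  `𝔲(J ⊗ 1)(E ⊗ ℝ) ⊆ closure (mixedEmbedding '' 𝔲(J)(E))` — every archimedean element `X` is `P(t • X)`, `t = ½ ⊗ 1`, and `P` maps the dense set
  `M_m(E) ⊗ 1` into the image of `𝔲(J)(E)`.
This is the Lie-algebra half of real weak approximation for `U(J)` (the Cayley transform and the passage to the group are files WA-2∕WA-3).
HONEST LABEL.  Count-neutral helper; `HC_CM` is proved only modulo the 7 printed citations (2 remaining named inputs: hLiu418 = `stmt-HodgeConjecture-24832`,
h413 = `stmt-HodgeConjecture-24833`) until rung 0 closes.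
-/

set_option autoImplicit false
set_option linter.dupNamespace false -- the mandated namespace repeats `HodgeConjecture.HodgeConjecture`

noncomputable section

namespace Summit.HodgeConjecture.HodgeConjecture.Cruxes.HLiu418.K2LiuUnitaryLieAlgebraRationalDense

open Topology Filter Set Function Matrix
open NumberField NumberField.mixedEmbedding
open Literature.NumberTheory.Automorphic Literature.NumberTheory.Automorphic.UnitaryGroup

/-! ## §1 Ring level: the retraction onto `𝔲(J)` -/

section Ring

variable {R S : Type*} [CommRing R] [CommRing S] {m : Type*} [Fintype m] [DecidableEq m] (σ : R →+* R)

omit [DecidableEq m] in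
/-- `(A B)^† = B^† A^†` for `X^† = (X.map σ)ᵀ`. [folklore] -/
theorem conjTranspose_mul' (A B : Matrix m m R) : ((A * B).map σ)ᵀ = (B.map σ)ᵀ * (A.map σ)ᵀ := by
  rw [Matrix.map_mul, Matrix.transpose_mul]

omit [Fintype m] [DecidableEq m] in
/-- `(X^†)^† = X` for an involution `σ`. [folklore] -/
theorem conjTranspose_conjTranspose' (hσ : ∀ x, σ (σ x) = x) (X : Matrix m m R) : (((X.map σ)ᵀ).map σ)ᵀ = X := by
  rw [Matrix.transpose_map, Matrix.transpose_transpose, Matrix.map_map]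
  exact Matrix.ext fun i j => hσ (X i j)

/-- a two-sided inverse `K` of a hermitian `J` is hermitian: `K^† = K`. [folklore] -/
theorem conjTranspose_inv_eq {J K : Matrix m m R} (hJ : (J.map σ)ᵀ = J) (hJK : J * K = 1) :
    (K.map σ)ᵀ = K := by
  -- `K^† J = (J K)^† = 1` (using `J^† = J`), hence `K^† = K^† (J K) = K`
  have h1 : (K.map σ)ᵀ * J = 1 := by
    conv_lhs => rw [← hJ]
    rw [← conjTranspose_mul', hJK, Matrix.map_one _ (map_zero σ) (map_one σ), Matrix.transpose_one]
  calc (K.map σ)ᵀ = (K.map σ)ᵀ * (J * K) := by rw [hJK, Matrix.mul_one]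
    _ = K := by rw [← Matrix.mul_assoc, h1, Matrix.one_mul]

/-- **the retraction lands in `𝔲(J)`**: `P_K(Y) := Y − K Y^† J` satisfies `P_K(Y)^† J + J P_K(Y) = 0` (σ an involution, `J^† = J`, `K = J⁻¹`).
[cite: PlatonovRapinchuk1994, §7.1 Prop. 7.11] -/
theorem sub_mul_conjTranspose_mul_mem (hσ : ∀ x, σ (σ x) = x) {J K : Matrix m m R} (hJ : (J.map σ)ᵀ = J) (hJK : J * K = 1) (hKJ : K * J = 1)
    (Y : Matrix m m R) :
    ((Y - K * (Y.map σ)ᵀ * J).map σ)ᵀ * J + J * (Y - K * (Y.map σ)ᵀ * J) = 0 := by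
  have hK := conjTranspose_inv_eq σ hJ hJK
  have h1 : J * (Y * K) * J = J * Y := by rw [Matrix.mul_assoc, Matrix.mul_assoc, hKJ, Matrix.mul_one]
  have h2 : J * (K * (Y.map σ)ᵀ * J) = (Y.map σ)ᵀ * J := by rw [Matrix.mul_assoc K, ← Matrix.mul_assoc J K, hJK, Matrix.one_mul]
  rw [Matrix.map_sub _ (map_sub σ), Matrix.transpose_sub, conjTranspose_mul', conjTranspose_mul', hJ, conjTranspose_conjTranspose' σ hσ, hK,
    Matrix.sub_mul, Matrix.mul_sub, h1, h2]
  abel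

/-- **the retraction fixes `𝔲(J)` up to `2`**: for `Y ∈ 𝔲(J)` and a `σ`-fixed half `t` (`σ t = t`, `t * 2 = 1`), `P_K(t • Y) = Y`.
[cite: PlatonovRapinchuk1994, §7.1 Prop. 7.11] -/
theorem retraction_apply_of_mem {J K : Matrix m m R} (hKJ : K * J = 1) {t : R} (hσt : σ t = t) (ht2 : t * 2 = 1)
    {Y : Matrix m m R} (hY : (Y.map σ)ᵀ * J + J * Y = 0) :
    t • Y - K * ((t • Y).map σ)ᵀ * J = Y := by
  have hY' : (Y.map σ)ᵀ * J = -(J * Y) := eq_neg_of_add_eq_zero_left hY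
  have hmap : (t • Y).map σ = t • Y.map σ := by
    ext i j
    simp only [Matrix.map_apply, Matrix.smul_apply, smul_eq_mul, map_mul, hσt]
  rw [hmap, Matrix.transpose_smul, Matrix.mul_smul, Matrix.smul_mul, Matrix.mul_assoc, hY', Matrix.mul_neg, ← Matrix.mul_assoc, hKJ,
    Matrix.one_mul, smul_neg, sub_neg_eq_add, ← add_smul, ← mul_two, ht2, one_smul]

omit [DecidableEq m] in
/-- **the retraction commutes with ring homomorphisms intertwining the involutions** (`f ∘ σ = τ ∘ f`). [folklore] -/
theorem map_retraction (τ : S →+* S) (f : R →+* S) (hf : ∀ x, f (σ x) = τ (f x)) (J K Y : Matrix m m R) :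
    (Y - K * (Y.map σ)ᵀ * J).map f = Y.map f - K.map f * ((Y.map f).map τ)ᵀ * J.map f := by
  rw [Matrix.map_sub _ (map_sub f), Matrix.map_mul, Matrix.map_mul, ← Matrix.transpose_map, Matrix.map_map, Matrix.map_map,
    show (⇑f ∘ ⇑σ : R → S) = ⇑τ ∘ ⇑f from funext hf, Matrix.transpose_map]

omit [DecidableEq m] in
/-- membership in `𝔲(J)` is preserved by ring homomorphisms intertwining the involutions. [folklore] -/
theorem map_mem_unitaryLie (τ : S →+* S) (f : R →+* S) (hf : ∀ x, f (σ x) = τ (f x)) {J Y : Matrix m m R}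
    (hY : (Y.map σ)ᵀ * J + J * Y = 0) : ((Y.map f).map τ)ᵀ * J.map f + J.map f * Y.map f = 0 := by
  have h := congrArg (fun M : Matrix m m R => M.map f) hY
  rw [Matrix.map_add _ (map_add f), Matrix.map_mul, Matrix.map_mul, ← Matrix.transpose_map, Matrix.map_map,
    show (⇑f ∘ ⇑σ : R → S) = ⇑τ ∘ ⇑f from funext hf, ← Matrix.map_map, Matrix.map_zero _ (map_zero f)] at h
  exact h

end Ring

/-! ## §2 Number fields: density of `M(E)` in `M(E ⊗ ℝ)`, `conjMixed` is an involution -/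

section NumberField

variable (F E : Type) [Field F] [Field E] [NumberField E] [Algebra F E] (c : E ≃ₐ[F] E)

omit [Algebra F E] in
/-- **`E` is dense in `E ⊗_ℚ ℝ`** (Mathlib's weak approximation `InfiniteAdeleRing.denseRange_algebraMap` transported along the continuous
`ringEquiv_mixedSpace`). [cite: PlatonovRapinchuk1994, §1.2] -/
theorem denseRange_mixedEmbedding : DenseRange (mixedEmbedding E) := by
  have h : (mixedEmbedding E : E → mixedSpace E) = (InfiniteAdeleRing.ringEquiv_mixedSpace E) ∘ (algebraMap E (InfiniteAdeleRing E)) :=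
    funext fun _ => InfiniteAdeleRing.mixedEmbedding_eq_algebraMap_comp E
  rw [h]
  exact (InfiniteAdeleRing.ringEquiv_mixedSpace E).surjective.denseRange.comp (InfiniteAdeleRing.denseRange_algebraMap E)
    (continuous_ringEquiv_mixedSpace E)

omit [Algebra F E] in
/-- **`M_{m×m′}(E)` is dense in `M_{m×m′}(E ⊗ ℝ)`** (entrywise). [cite: PlatonovRapinchuk1994, §1.2] -/
theorem denseRange_matrix_map_mixedEmbedding {m m' : Type*} :
    DenseRange fun X : Matrix m m' E => X.map (mixedEmbedding E) :=
  DenseRange.piMap fun _ => DenseRange.piMap fun _ => denseRange_mixedEmbedding E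

end NumberField

/-! ## §3 The rational unitary Lie algebra is dense in the archimedean one -/

section Density

variable (F E : Type) [Field F] [Field E] [NumberField E] [Algebra F E] (c : E ≃ₐ[F] E) {m : Type*} [Fintype m] [DecidableEq m]

/-- **REAL APPROXIMATION FOR THE UNITARY LIE ALGEBRA.**  For `c` an involution of `E/F` and `J ∈ M_m(E)` hermitian (`(J.map c)ᵀ = J`) of unit
determinant, every element of the archimedean Lie algebra `𝔲(J ⊗ 1)(E ⊗ ℝ) = {X | (X.map (c⊗1))ᵀ (J⊗1) + (J⊗1) X = 0}` is a limit of images of elements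
of the rational Lie algebra `𝔲(J)(E)`. [cite: PlatonovRapinchuk1994, §7.1 Prop. 7.11] -/
theorem unitaryLie_subset_closure_image (hc : ∀ x, c (c x) = x) {J : Matrix m m E} (hJ : (J.map (c : E →+* E))ᵀ = J) (hJu : IsUnit J.det) :
    {X : Matrix m m (mixedSpace E) | (X.map (conjMixed F E c))ᵀ * J.map (mixedEmbedding E) + J.map (mixedEmbedding E) * X = 0} ⊆
      closure ((fun X : Matrix m m E => X.map (mixedEmbedding E)) '' {Y : Matrix m m E | (Y.map (c : E →+* E))ᵀ * J + J * Y = 0}) := by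
  intro X hX
  -- the data over `E ⊗ ℝ`: involution, hermitian form, inverse, the half `t = ½ ⊗ 1`
  have hσ : ∀ x, conjMixed F E c (conjMixed F E c x) = x := conjMixed_conjMixed_of_apply_apply F E c hc
  have hcomp : ∀ x, mixedEmbedding E ((c : E →+* E) x) = conjMixed F E c (mixedEmbedding E x) := fun x => (conjMixed_mixedEmbedding F E c x).symm
  have hJK : J * J⁻¹ = 1 := Matrix.mul_nonsing_inv J hJu
  have hKJ : J⁻¹ * J = 1 := Matrix.nonsing_inv_mul J hJu
  have hJK' : J.map (mixedEmbedding E) * J⁻¹.map (mixedEmbedding E) = 1 := by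
    rw [← Matrix.map_mul, hJK, Matrix.map_one _ (map_zero _) (map_one _)]
  have hKJ' : J⁻¹.map (mixedEmbedding E) * J.map (mixedEmbedding E) = 1 := by
    rw [← Matrix.map_mul, hKJ, Matrix.map_one _ (map_zero _) (map_one _)]
  have hJ' : ((J.map (mixedEmbedding E)).map (conjMixed F E c))ᵀ = J.map (mixedEmbedding E) := by
    rw [Matrix.map_map, show (⇑(conjMixed F E c) ∘ ⇑(mixedEmbedding E) : E → mixedSpace E) = ⇑(mixedEmbedding E) ∘ ⇑(c : E →+* E) from
      funext fun x => (hcomp x).symm, ← Matrix.map_map, ← Matrix.transpose_map, hJ]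
  have ht : conjMixed F E c (mixedEmbedding E (2⁻¹ : E)) = mixedEmbedding E (2⁻¹ : E) := by
    rw [conjMixed_mixedEmbedding, map_inv₀, map_ofNat]
  have ht2 : mixedEmbedding E (2⁻¹ : E) * 2 = 1 := by
    rw [← map_ofNat (mixedEmbedding E) 2, ← map_mul, inv_mul_cancel₀ (two_ne_zero : (2 : E) ≠ 0), map_one]
  -- `X = P(t • X)` with `P` the retraction over `E ⊗ ℝ`
  have hPX := retraction_apply_of_mem (conjMixed F E c) hKJ' ht ht2 hX
  rw [← hPX]
  -- `P` is continuous and maps the dense set `M(E) ⊗ 1` into the image of `𝔲(J)(E)`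
  have hP : Continuous fun Y : Matrix m m (mixedSpace E) =>
      Y - J⁻¹.map (mixedEmbedding E) * (Y.map (conjMixed F E c))ᵀ * J.map (mixedEmbedding E) :=
    continuous_id.sub ((continuous_const.mul (continuous_id.matrix_map (continuous_conjMixed F E c)).matrix_transpose).mul continuous_const)
  have hmem : (fun Y : Matrix m m (mixedSpace E) => Y - J⁻¹.map (mixedEmbedding E) * (Y.map (conjMixed F E c))ᵀ * J.map (mixedEmbedding E))
      (mixedEmbedding E (2⁻¹ : E) • X) ∈
      closure ((fun X : Matrix m m E => X.map (mixedEmbedding E)) '' {Y : Matrix m m E | (Y.map (c : E →+* E))ᵀ * J + J * Y = 0}) := by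
    refine map_mem_closure (f := fun Y : Matrix m m (mixedSpace E) =>
        Y - J⁻¹.map (mixedEmbedding E) * (Y.map (conjMixed F E c))ᵀ * J.map (mixedEmbedding E))
      (x := mixedEmbedding E (2⁻¹ : E) • X) (s := Set.range fun X : Matrix m m E => X.map (mixedEmbedding E)) hP
      (by rw [(denseRange_matrix_map_mixedEmbedding E).closure_range]; exact Set.mem_univ _) ?_
    rintro _ ⟨Z, rfl⟩
    exact ⟨Z - J⁻¹ * (Z.map (c : E →+* E))ᵀ * J, sub_mul_conjTranspose_mul_mem (c : E →+* E) hc hJ hJK hKJ Z,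
      map_retraction (c : E →+* E) (conjMixed F E c) (mixedEmbedding E) hcomp J J⁻¹ Z⟩
  exact hmem

end Density

end Summit.HodgeConjecture.HodgeConjecture.Cruxes.HLiu418.K2LiuUnitaryLieAlgebraRationalDense
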